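import Literature.MathematicalPhysics.QuantumFieldTheory.Balaban1983to89.B9Letters313AtOneQ
import Literature.MathematicalPhysics.QuantumFieldTheory.Balaban1983to89.B9CoReadingCoordsS

/-!
# `Balaban1983to89.B9Letters313AtOneDv` — [B9] Thm 3.13's reduction letters AT THE TRIVIAL BACKGROUND, fourth batch: the gauge-sector gradient
# letters `Letters313.gD1 ∕ gD2` (= `Letters313Z.gD1 ∕ gD2`) — `G₀(1)∘D_v(1) : 𝔠_W⁽⁰⁾ → 𝔠⁽¹⁾` and `𝔠_W⁽¹⁾ → 𝔠⁽²⁾` — HOLD AT `U = 1` at node00-def-Y's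
# pinned letters, uniformly on the k-level census: [4] Prop. 2.6 (2.136)₃ (`G∇*`) READ ONTO `G₀∂` through the identity `∂λ = −Σ_μ ∇*_μ J_μ(λ)`

T. Bałaban, *Propagators for lattice gauge theories in a background field*, Commun. Math. Phys. **99** (1985) 389–434
[`Balaban1985BackgroundPropagators`, "B9"]; [4] = T. Bałaban, *Propagators and renormalization transformations for lattice gauge
theories. II*, Commun. Math. Phys. **96** (1984) 223–250 [`Balaban1984PropagatorsII`].

statement-level skeleton of published theorems with citation tags; proofs where landed; nothing here is a claim about the Yang–Mills mass gap

THE PRINTED LOCI (verbatim).  [B9] p. 426 (Thm 3.13): *"The formulas (3.147), (3.153) permit us to reduce properties of the operators 𝔓, 𝔊 to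
the corresponding properties of the operators G′, (Q′G′²Q′\*)⁻¹, G₁, (QG₁Q\*)⁻¹"*, (3.153): 𝔊 = G₁ − G₁Q\*(QG₁Q\*)⁻¹QG₁ − G₁DRD\*G₁ (the letter
`G₁D`, D = the gauge-sector covariant gradient (3.3) p. 390: *"(D_Uλ)(b) = η⁻¹(R(U(b))λ(b₊) − λ(b₋))"*, (3.17) p. 394, (3.122) p. 419); p. 407, before
Cor. 3.5: *"There we have proved these theorems for operators with the external gauge field configuration U = 1."*  [4] Prop. 2.6 p. 247:
*"|(GJ)(x)|, |(∇GJ)(x)|, |(G∇\*J)(x)|, |(ΔGJ)(x)| ≤ O(1)[(L^jη)², L^jη, L^jη, 1]e^{−δ₃d(y,y′)}|J| (2.136) for x ∈ Δ(y), y ∈ Λ_j, supp J ⊂ Δ(y′)"*;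
Lemma 2.1 (2.60)–(2.61) p. 234; (2.45)–(2.46) p. 231 (blocks of neighbouring sites).

THE POINT.  dag-n06-d's N06 certificate (editions 19–22, `Summits/…/BalabanUVNodesN06AtOpsYNuOfRecordV6EPairM* ∕ N*`) displays the binder
`hletters13 : … → B9Thm313Whole.Letters313 (𝔬12 x) 1 (H x) … B12₃ δ12₃ U` (dag-n06-l; in edition 22 its Z species `Letters313Z`, whose `gD1 ∕ gD2`
fields are literally the same).  At `U ↦ 1`, dag-n06-h inhabited `gQs2` (`B9LettersHAtOneG0`), this seat `q2 ∕ q1 ∕ gQs1` (`B9Letters313AtOneQ`);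
dag-n06-h's census (pub-ymgap bus l.23899 ∕ l.24191) left `gD1 ∕ gD2` OPEN with the caveat that (2.136) has no verbatim entry for `G∂λ`, `λ` a SCALAR.
THIS FILE meets the caveat: §1 (torus chart) `∂λ = −Σ_μ ∇*_μ J_μ(λ)`, `J_μ(λ)(b) := [b.dir = μ]·λ(b₊)` (`onFun_dE_eq_neg_sum_DVa`; `∇*_μ` = p38's `DVa`
of the census), so `G∂ = −Σ_μ (G∇*_μ)(J_μ ·)` and (2.136)₃ — N03's hypothesis-free `prop26Printed_kLevel` via dag-n06-h's `hasMajorant_Gop_kIdx`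
(third conjunct) — applies slice by slice; `|J_μ(λ)| ≤ |λ|`; `supp J_μ(λ)` sits one site off `supp λ`, i.e. within torus block distance `2` of the
carrier block (`distB_blkV1_shift_le_one` from p21's `distT_shift_le_one` + the 1-faithfulness `hβ1` of the certificate's `bI`), re-blocked by
dag-n06-h's `abs_apply_le_of_near` (Lemma 2.1 (2.61) at a quarter of the rate): ★★ `hasMajorantHom_comp_gradK_sIK_bI`.  §2 (pins): node00-def-Y's
`D_v(1) = gradK♯` (`Node00.gradY_one`), so `GcoK … O U₁ ∘ DvcoKH … U₁ = cR39 b • coordOpKH b (fun _ => O(1) ∘ D_1)` acts on `ω ⊗ E` as `(G(gradK·ω)) ⊗ E`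
and dag-n06-d's functor carries §1 slice by slice (dag-n06-h `hasMajorantHom_coordOpKH_of_liftY`): ★★ `hasMajorantHom_GcoK_DvcoKH_one`; in the state
classes ★★★ `hasMaj_G0_Dv_one` (the `gD1` shape `cNorm … blkW … 0 → cNorm … blk … 1`) and ★★★ `hasMaj_G0_Dv_one_transfer` (the `gD2` shape `cNorm … blkW … 1
→ cNorm … blk … 2`, one power of `Lʲη` moved to the source block by (2.60) under an M-threshold), at ANY letter record `𝔬` with `G0 ∕ Dv` pinned to
`GcoK … O ∕ DvcoKH` (the certificate's `hG0co12 ∕ hDvco12`), `blk = blkBK bI` (`hblk12`) and the SITE PIN `blkW = blkSK (sIK bI)` (the certificate leaves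
`(𝔬12 x).blkW` unpinned; this is the site-carrier block map of rows 18 ∕ 25, `B9CoReadingCoordsInputS` ∕ `B9Ineq349SiteFromPinsPairM`).  §3 ★★★
`letters313_Dv_one_kIdx`: both bodies UNIFORMLY on the census (one threshold, one rate `δ₃∕2`, one constant `B₃·cR39 b`).

HONEST SCOPE.  A READING file: the analytic inputs are N03's Prop. 2.6 (via dag-n06-h's `hasMajorant_Gop_kIdx`), p21's Lemma 2.1
(`consts_260_261`), the (2.60) transfer and p21's neighbouring-block lemma, all tree theorems cited by name; pins ∕ carriers ∕ functor are
dag-n06-d's, letters node00-def-Y's, schema dag-n06-l's; nothing of [B9] at curved `U` is asserted and the displayed `∀U`-binder `hletters13` is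
NOT witnessed (an A6 partial witness at `U = 1` only); the `R ∕ D*_v ∕ G₁` letters (`rgd1 ∕ rgd2`), the `∇G₀∂` letters (entry (2.138), Hölder source
class), the Hölder-probe letters (2.137), the L² letters (2.140) and the C-letters are NOT treated here.  COUNT-NEUTRAL; N06 is NOT discharged; one
finite lattice at a time; nothing continuum, nothing about the mass gap.  Cell `pub-ymgap` (HUMAN RULING D-0062 ∕ D-0149), Track A node N06 [B9],
width seat `pub-ymgap-dag-n06-w3` (g2), 2026-08-28.
-/

noncomputable section

namespace Literature.MathematicalPhysics.QuantumFieldTheory.Balaban1983to89.B9Letters313AtOneDv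

open B6MultiLevelTorusOperator (TDomains) open B6Geom246MultiLevelTorus (geomT) open B6GlobalChartV1 (PV blkV1 boxEquiv toBox) open B6Geom246MultiLevelBox (bset blkOf)
open B6KLevelCensusIndexV1 (KIdx kGeo kGeoG) open B6Prop26Census2136KLevelV1 (Gop) open B6RandomWalk (HasMajorant BlockSupp) open B6RandomWalkHom (HasMajorantHom)
open B6LapLegKLevelV1 (DVa DVa_apply) open B6Ineq2133TwoScaleV1 (onFun onFun_apply) open B6SectAOperatorsV1 (dE dE_apply) open LatticeFieldCalculus (grad)
open B10StarCount (shift_unshift unshift_shift) open B6Ineq2142KLevelV1 (lvl β distT_shift_le_one) open B6Ineq288MultiLevelTorus (dist_symm_geoBT)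
open B9Thm314GpFlatMultiLevelTorus (consts_260_261) open B6Lemma21Repaired (Ineq261With) open B9GeoNormsKLevelV1 (geo9K)
open B9GeoLemma21KLevelV1 (one_le_Mh geo9K_len_pos geo9K_dist_comm geo9K_M_nonneg) open B9Ineq349SiteComposite (distB distB_nonneg)
open B9Ineq349SiteFromBlocks (distB_triangle) open B9Thm39ReadingCoords (cR39 cR39_nonneg) open B9CoReadingCoords B9CoReadingCoordsH
open B9CoReadingCoordsS (XSK blkSK sIK blkV1_site) open B9Prop26AtPinsOne (hasMajorant_Gop_kIdx hasMajorantHom_coordOpKH_of_liftY)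
open B9LettersHAtOneG0 (abs_apply_le_of_near hasMaj_cNorm_of_hasMajorantHom_pow)
open B9Letters313AtOneQ (hasMajorantHom_smul_of_nonneg len_pow_le_of_transfer transfer_threshold) open Node00 Node00.OpsYSectDCoords open B9Thm34Ext (toB6)
open B9Thm312Whole B9Thm312WholeLeaf B9SectDSup B11SectG
open scoped Matrix

variable {d ℓ : ℕ} {hd : 1 ≤ d + 1} {hL : Odd (ℓ + 1) ∧ 1 < ℓ + 1} {b₀ b₁ : ℝ}

/-! ## §1 ON THE TORUS CHART: the flat gradient of a scalar is a sum of backward differences of direction-sliced shifted copies -/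

section Flat

variable (i : KIdx d ℓ hd hL b₀ b₁)

/-- **`Σ_μ ∇*_μ J_μ(g) = −∂g` ENTRYWISE**, where `J_μ(g)(b) := [b.dir = μ]·g(b₊)` is the direction-`μ` slice of the scalar `g` shifted to the far
endpoint: at `b = ⟨x, ν⟩` only `μ = ν` contributes, with `c_f·(g(x) − g(x + e_ν))`. [cite: Balaban1984PropagatorsI, (1.4) p.18, (1.89) p.33 («∇*»); Balaban1984PropagatorsII, (2.7)–(2.8) p.224, bookkeeping] -/
theorem sum_DVa_dirSlice_apply (g : Site (PV d ℓ i.m i.K hd hL) 0 → ℝ) (b : FBondY i) :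
    (∑ μ : Fin (d + 1), DVa (P := PV d ℓ i.m i.K hd hL) μ i.cf (fun b' : FBondY i => if b'.dir = μ then g (b'.src.shift μ) else 0)) b =
      i.cf * (g b.src - g (b.src.shift b.dir)) := by
  rw [Finset.sum_apply]
  have hterm : ∀ μ : Fin (d + 1), DVa (P := PV d ℓ i.m i.K hd hL) μ i.cf (fun b' : FBondY i => if b'.dir = μ then g (b'.src.shift μ) else 0) b =
      if b.dir = μ then i.cf * (g b.src - g (b.src.shift μ)) else 0 := fun μ => by
    rw [DVa_apply]
    by_cases h : b.dir = μ
    · simp only [h, if_true, shift_unshift]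
    · simp only [h, if_false, sub_zero, mul_zero]
  simp only [hterm, Finset.sum_ite_eq, Finset.mem_univ, if_true]

/-- **`∂g = −Σ_μ ∇*_μ J_μ(g)` AS BOND FUNCTIONS** (r03's `dE c_f` read on functions). [cite: Balaban1984PropagatorsI, (1.4) p.18, (1.89) p.33; Balaban1984PropagatorsII, (2.7)–(2.8) p.224, bookkeeping] -/
theorem onFun_dE_eq_neg_sum_DVa (g : Site (PV d ℓ i.m i.K hd hL) 0 → ℝ) :
    onFun (dE (P := PV d ℓ i.m i.K hd hL) i.cf) g =
      -∑ μ : Fin (d + 1), DVa (P := PV d ℓ i.m i.K hd hL) μ i.cf (fun b' : FBondY i => if b'.dir = μ then g (b'.src.shift μ) else 0) := by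
  funext b
  rw [Pi.neg_apply, sum_DVa_dirSlice_apply, onFun_apply, dE_apply]
  simp only [grad, PBond.tgt, smul_eq_mul]
  ring

/-- **THE TARGET RE-BLOCKING** of dag-n06-h's `abs_apply_le_of_near` bound into the index-bond geometry `geo9K` (the last step of
`B9LettersHAtOneG0.hasMajorantHom_comp_qsK_bI`, isolated): a LEVEL- and 1-FAITHFUL `bI` turns `ηᵐL^{mj(f)}` into `(Lʲη)(bI f)ᵐ` and costs one unit of
distance. [cite: Balaban1984PropagatorsII, (2.51)–(2.52) p.232, (2.45)–(2.46) p.231; Balaban1985BackgroundPropagators, (3.41) p.397, bookkeeping] -/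
theorem reblock_target {bI : FBondY i → IBondY i} (hlev : ∀ f : FBondY i, lvl i.hN i.D i.hk (bI f) = (blkV1 i.hN i.D f).1.1)
    (hβ1 : ∀ f : FBondY i, (geomT i.D).dist (β i.hN i.D i.hk (bI f)) (blkV1 i.hN i.D f) ≤ 1)
    {C δ c B r : ℝ} (hC : 0 ≤ C) (hδ : 0 ≤ δ) (hc : 0 ≤ c) (hB : 0 ≤ B) (m : ℕ) (a' : IBondY i) (f : FBondY i) [Fintype (geo9K i).Site] :
    C * |i.cf|⁻¹ ^ m * ((ℓ : ℝ) + 1) ^ (m * (blkV1 i.hN i.D f).1.1) * B * c * Real.exp (3 / 4 * δ * r) *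
        Real.exp (-(3 / 4 * δ * distB i (blkV1 i.hN i.D f) (β i.hN i.D i.hk a'))) ≤
      C * c * Real.exp (3 / 4 * δ * (r + 1)) * (geo9K i).len (bI f) ^ m * Real.exp (-(3 / 4 * δ * (geo9K i).dist (bI f) a')) * B := by
  set bf := blkV1 i.hN i.D f with hbf
  have htri2 : (geo9K i).dist (bI f) a' ≤ 1 + distB i bf (β i.hN i.D i.hk a') := by
    change distB i (β i.hN i.D i.hk (bI f)) (β i.hN i.D i.hk a') ≤ 1 + distB i bf (β i.hN i.D i.hk a')
    have h1 : distB i (β i.hN i.D i.hk (bI f)) bf ≤ 1 := hβ1 f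
    linarith [distB_triangle i (β i.hN i.D i.hk (bI f)) bf (β i.hN i.D i.hk a')]
  have hexp2 : Real.exp (-(3 / 4 * δ * distB i bf (β i.hN i.D i.hk a'))) ≤
      Real.exp (3 / 4 * δ) * Real.exp (-(3 / 4 * δ * (geo9K i).dist (bI f) a')) := by
    rw [← Real.exp_add]; exact Real.exp_le_exp.2 (by nlinarith [mul_le_mul_of_nonneg_left htri2 (show (0 : ℝ) ≤ 3 / 4 * δ by positivity)])
  have hlen : |i.cf|⁻¹ ^ m * ((ℓ : ℝ) + 1) ^ (m * bf.1.1) = (geo9K i).len (bI f) ^ m := by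
    rw [B9GeoNormsKLevelV1.geo9K_len_kGeo, B6KLevelCensusIndexV1.len_eq, hlev f, ← hbf, div_eq_mul_inv, mul_pow, ← pow_mul, mul_comm]
    push_cast; ring
  have h0 : 0 ≤ C * |i.cf|⁻¹ ^ m * ((ℓ : ℝ) + 1) ^ (m * bf.1.1) * B * c * Real.exp (3 / 4 * δ * r) := by positivity
  refine (mul_le_mul_of_nonneg_left hexp2 h0).trans (le_of_eq ?_)
  rw [← hlen, show 3 / 4 * δ * (r + 1) = 3 / 4 * δ * r + 3 / 4 * δ by ring, Real.exp_add]; ring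

/-- **the blocks of a bond and of its translate by `e_μ` are equal or adjacent** (`blkV1` reads the initial point). [cite: Balaban1984PropagatorsII, (2.46) p.231, bookkeeping] -/
theorem distB_blkV1_shift_le_one (x : Site (PV d ℓ i.m i.K hd hL) 0) (μ ν ν' : Fin (d + 1)) :
    distB i (blkV1 i.hN i.D (⟨x.shift μ, ν⟩ : FBondY i)) (blkV1 i.hN i.D (⟨x, ν'⟩ : FBondY i)) ≤ 1 := by
  rw [distB, dist_symm_geoBT]
  change (((B6Geom246MultiLevelTorus.bondT i.D).dist (blkOf i.D.toDomains (toBox i.hN x))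
    (blkOf i.D.toDomains (toBox i.hN (x.shift μ))) : ℕ) : ℝ) ≤ 1
  exact_mod_cast distT_shift_le_one i.hN i.D x μ

/-- ★★ **RE-BLOCKING THROUGH THE FLAT SCALAR GRADIENT `∂♯ = gradK`**: a real operator `T` on the fine bonds whose composites `T ∘ ∇*_μ` have the
torus block majorant `C·ηᵐL^{mj(y)}·e^{−δd_T}` (the shape of (2.136)₃ for `G∇*_μ`) gives, after NODE 00's flat gradient kernel (`∂λ`, scalar `λ` on the
box chart), an operator from SITE functions (block map = the site pin `sIK bI`, `z ↦ bI⟨z, e₀⟩`) to fine-bond functions (block map `bI`) with the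
majorant `(d+1)·C·c·e^{¾δ(ℓ+4)}·(Lʲη)(a)ᵐ·e^{−¾δd(a,a′)}` — `∂λ = −Σ_μ∇*_μJ_μ(λ)`, `|J_μ(λ)| ≤ |λ|`, `supp J_μ(λ)` within torus distance `2 ≤ ℓ + 3` of the
carrier block of `a′` (`hβ1` + `distB_blkV1_shift_le_one`), dag-n06-h's `abs_apply_le_of_near` ((2.52) summed by (2.61)), `reblock_target`, `Σ_μ`.
[cite: Balaban1984PropagatorsII, Prop. 2.6 (2.136) p.247 (third entry), (2.51)–(2.52) p.232, Lemma 2.1 (2.61) p.234, (2.45)–(2.46) p.231; Balaban1985BackgroundPropagators, (3.3) p.390, p.398 (remark after (3.47))] -/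
theorem hasMajorantHom_comp_gradK_sIK_bI {bI : FBondY i → IBondY i}
    (hlev : ∀ f : FBondY i, lvl i.hN i.D i.hk (bI f) = (blkV1 i.hN i.D f).1.1)
    (hβ1 : ∀ f : FBondY i, (geomT i.D).dist (β i.hN i.D i.hk (bI f)) (blkV1 i.hN i.D f) ≤ 1)
    {T : Module.End ℝ (FBondY i → ℝ)} {C δ : ℝ} (hC : 0 ≤ C) (hδ : 0 ≤ δ) (m : ℕ)
    (hT : ∀ μ : Fin (d + 1), HasMajorant (g := geomT i.D) (blkV1 i.hN i.D) (T ∘ₗ DVa (P := PV d ℓ i.m i.K hd hL) μ i.cf)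
      (fun y y' => C * |i.cf|⁻¹ ^ m * ((ℓ : ℝ) + 1) ^ (m * y.1.1) * Real.exp (-(δ * (geomT i.D).dist y y'))))
    {c : ℝ} (h261 : Ineq261With c (geomT i.D) δ (1 / 4)) (R₀ : ℝ) (H₀ : Prop) [Fintype (geo9K i).Site] :
    HasMajorantHom (g := toB6 (geo9K i) R₀ H₀) (sIK i bI) bI (T ∘ₗ Matrix.toLin' (gradK i))
      (fun a a' => ((d : ℝ) + 1) * (C * c * Real.exp (3 / 4 * δ * ((ℓ : ℝ) + 4)) * (geo9K i).len a ^ m *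
        Real.exp (-(3 / 4 * δ * (geo9K i).dist a a')))) := by
  classical
  intro a' ω Bω hω f
  change IBondY i at a'
  -- the source on the torus chart and its slices
  set g : Site (PV d ℓ i.m i.K hd hL) 0 → ℝ := fun x => ω (boxEquiv i.hN x) with hg
  have hgrad : Matrix.toLin' (gradK i) ω = onFun (dE (P := PV d ℓ i.m i.K hd hL) i.cf) g := by rw [Matrix.toLin'_apply, gradK_mulVec]
  -- each slice `J_μ(g)` is bounded by `Bω` and supported within torus distance `ℓ + 3` of the carrier block of `a′`
  have hsite : ∀ x : Site (PV d ℓ i.m i.K hd hL) 0, ω (boxEquiv i.hN x) ≠ 0 → bI ⟨x, 0⟩ = a' := fun x hx => by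
    by_contra hne; exact hx (hω.off (boxEquiv i.hN x) (by rwa [sIK, Equiv.symm_apply_apply]))
  have hvB : ∀ (μ : Fin (d + 1)) (z : FBondY i), |(fun b' : FBondY i => if b'.dir = μ then g (b'.src.shift μ) else 0) z| ≤ Bω := by
    intro μ z
    by_cases hz : z.dir = μ
    · simp only [hz, if_true, hg]
      by_cases h0 : ω (boxEquiv i.hN (z.src.shift μ)) = 0
      · rw [h0, abs_zero]; exact hω.nonneg
      · exact hω.bound _ (by rw [sIK, Equiv.symm_apply_apply]; exact hsite _ h0)
    · simp only [hz, if_false, abs_zero]; exact hω.nonneg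
  have hc0 : 0 ≤ c := le_trans (Finset.sum_nonneg fun y _ => (Real.exp_pos _).le) (h261 (blkV1 i.hN i.D f))
  have hvS : ∀ (μ : Fin (d + 1)) (z : FBondY i), (fun b' : FBondY i => if b'.dir = μ then g (b'.src.shift μ) else 0) z ≠ 0 →
      distB i (β i.hN i.D i.hk a') (blkV1 i.hN i.D z) ≤ (ℓ : ℝ) + 3 := by
    intro μ z hz
    have hdir : z.dir = μ := by by_contra h; simp only [h, if_false] at hz; exact hz rfl
    simp only [hdir, if_true, hg] at hz
    have ha : bI ⟨z.src.shift μ, 0⟩ = a' := hsite _ hz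
    have h1 : distB i (β i.hN i.D i.hk a') (blkV1 i.hN i.D (⟨z.src.shift μ, 0⟩ : FBondY i)) ≤ 1 := by rw [← ha]; exact hβ1 _
    have h2 : distB i (blkV1 i.hN i.D (⟨z.src.shift μ, 0⟩ : FBondY i)) (blkV1 i.hN i.D z) ≤ 1 := by
      obtain ⟨x, ν⟩ := z; exact distB_blkV1_shift_le_one i x μ 0 ν
    linarith [(Nat.cast_nonneg ℓ : (0 : ℝ) ≤ ℓ), distB_triangle i (β i.hN i.D i.hk a') (blkV1 i.hN i.D (⟨z.src.shift μ, 0⟩ : FBondY i)) (blkV1 i.hN i.D z)]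
  -- `T(∂λ) = −Σ_μ (T ∘ ∇*_μ)(J_μ)`; each term by `abs_apply_le_of_near`, re-blocked
  have hsum : (T ∘ₗ Matrix.toLin' (gradK i)) ω f =
      -∑ μ : Fin (d + 1), (T ∘ₗ DVa (P := PV d ℓ i.m i.K hd hL) μ i.cf) (fun b' : FBondY i => if b'.dir = μ then g (b'.src.shift μ) else 0) f := by
    rw [LinearMap.comp_apply, hgrad, onFun_dE_eq_neg_sum_DVa, map_neg, map_sum, Pi.neg_apply, Finset.sum_apply]
    simp only [LinearMap.comp_apply]
  have hterm : ∀ μ : Fin (d + 1), |(T ∘ₗ DVa (P := PV d ℓ i.m i.K hd hL) μ i.cf) (fun b' : FBondY i => if b'.dir = μ then g (b'.src.shift μ) else 0) f| ≤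
      C * c * Real.exp (3 / 4 * δ * ((ℓ : ℝ) + 4)) * (geo9K i).len (bI f) ^ m * Real.exp (-(3 / 4 * δ * (geo9K i).dist (bI f) a')) * Bω :=
    fun μ => by
    have hmain := abs_apply_le_of_near i hC hδ m (hT μ) h261 (β i.hN i.D i.hk a') hω.nonneg _ (hvB μ) (hvS μ) f
    have hre := reblock_target i hlev hβ1 hC hδ hc0 hω.nonneg m a' f (r := (ℓ : ℝ) + 3)
    rw [show (ℓ : ℝ) + 3 + 1 = (ℓ : ℝ) + 4 by ring] at hre
    exact hmain.trans hre
  rw [hsum, abs_neg]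
  refine ((Finset.abs_sum_le_sum_abs _ _).trans (Finset.sum_le_sum fun μ _ => hterm μ)).trans (le_of_eq ?_)
  rw [Finset.sum_const, Finset.card_univ, Fintype.card_fin, nsmul_eq_mul]; push_cast; ring

end Flat

/-! ## §2 AT THE PINS: `G₀(U₁)∘D_v(U₁)` at a configuration reading `1` is the mixed model of `G ∘ ∂♯`; the letters `gD1 ∕ gD2` in the state classes -/

section Letters

variable {𝔸 : Type} [NormedRing 𝔸] [NormedAlgebra ℂ 𝔸] [CompleteSpace 𝔸] [FiniteDimensional ℝ 𝔸]
variable {κ : Type} [Fintype κ]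
variable (i : KIdx d ℓ hd hL b₀ b₁) (b : Module.Basis κ ℝ 𝔸) (B : B9.Backgrounds) (cfg : B.Cfg → CfgY 𝔸 i) (O : BondOpY 𝔸 i)

/-- ★ **THE COMPOSITE `G₀∘D_v` AT THE PINS, AT `U = 1`, IS THE MIXED MODEL OF THE FLAT FAMILY `G_A(1) ∘ D_1`** (node00-def-Y's `GcoK … O` after the
UNSCALED gauge-sector gradient model `DvcoKH`; the reading constant `cR39 b` of `GcoK` survives, as in dag-n06-h's `hasMajorant_GcoK_DscoK_of_liftY`).
[cite: Balaban1985BackgroundPropagators, (3.3) p.390, (3.17) p.394, (3.122) p.419, Cor. 3.5 p.407, dictionary] -/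
theorem GcoK_comp_DvcoKH_one {U₁ : B.Cfg} (hU₁ : cfg U₁ = fun _ _ => 1) :
    GcoK i b B cfg O U₁ ∘ₗ DvcoKH i b B cfg U₁ =
      cR39 b • coordOpKH b (fun _ : Fin (d + 1) => (O (fun _ _ => 1)).restrictScalars ℝ ∘ₗ (gradY i (fun _ _ => 1)).restrictScalars ℝ) := by
  rw [GcoK, DvcoKH, hU₁, LinearMap.smul_comp, coordOpK_comp_coordOpKH]

omit [FiniteDimensional ℝ 𝔸] [Fintype κ] in
/-- the flat family `G_A(1) ∘ D_1` acts on product-form inputs as the real operator `G ∘ ∂♯` (`GAY_one_liftY`-type clause for `O`, node00-def-Y's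
`gradY_one = liftMatY (gradK)`). [cite: Balaban1985BackgroundPropagators, (3.3) p.390 + p.395 («coincides … if U = 1»), Cor. 3.5 p.407, dictionary] -/
theorem O_gradY_one_liftY (hO : ∀ (J : FBondY i → ℝ) (E : 𝔸), O (fun _ _ => 1) (liftY J E) = liftY (Gop i J) E) (ω : SiteY i → ℝ) (E : 𝔸) :
    ((O (fun _ _ => 1)).restrictScalars ℝ ∘ₗ (gradY i (fun _ _ => 1)).restrictScalars ℝ) (liftY ω E) =
      liftY ((Gop i ∘ₗ Matrix.toLin' (gradK i)) ω) E := by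
  rw [LinearMap.comp_apply, LinearMap.restrictScalars_apply, LinearMap.restrictScalars_apply, gradY_one, liftMatY_liftY, hO,
    LinearMap.comp_apply, Matrix.toLin'_apply]

variable {Y Z : Type}

/-- ★★ **THE MODEL `G₀(U₁)∘D_v(U₁)` AT `U = 1` HAS THE TWO-SPACE MAJORANT `cR39 b·(d+1)·C·c·e^{¾δ(ℓ+4)}·(Lʲη)(a)·e^{−¾δd(a,a′)}`** from the site carrier
(block map `blkSK (sIK bI)`) to the bond carrier (block map `blkBK bI`), for `O(1)(J ⊗ E) = (GJ) ⊗ E` and (2.136)₃ for `G ∘ ∇*_μ`.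
[cite: Balaban1984PropagatorsII, Prop. 2.6 (2.136) p.247 (third entry), (2.51) p.232, Lemma 2.1 (2.61) p.234; Balaban1985BackgroundPropagators, (3.3) p.390, (3.42) p.397, Cor. 3.5 p.407] -/
theorem hasMajorantHom_GcoK_DvcoKH_one (hO : ∀ (J : FBondY i → ℝ) (E : 𝔸), O (fun _ _ => 1) (liftY J E) = liftY (Gop i J) E)
    {U₁ : B.Cfg} (hU₁ : cfg U₁ = fun _ _ => 1)
    {bI : FBondY i → IBondY i} (hlev : ∀ f : FBondY i, lvl i.hN i.D i.hk (bI f) = (blkV1 i.hN i.D f).1.1)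
    (hβ1 : ∀ f : FBondY i, (geomT i.D).dist (β i.hN i.D i.hk (bI f)) (blkV1 i.hN i.D f) ≤ 1)
    {C δ c : ℝ} (hC : 0 ≤ C) (hδ : 0 ≤ δ)
    (hT : ∀ μ : Fin (d + 1), HasMajorant (g := geomT i.D) (blkV1 i.hN i.D) (Gop i ∘ₗ DVa (P := PV d ℓ i.m i.K hd hL) μ i.cf)
      (fun y y' => C * |i.cf|⁻¹ ^ 1 * ((ℓ : ℝ) + 1) ^ (1 * y.1.1) * Real.exp (-(δ * (geomT i.D).dist y y'))))
    (h261 : Ineq261With c (geomT i.D) δ (1 / 4)) (R₀ : ℝ) (H₀ : Prop) [Fintype (geo9K i).Site] :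
    HasMajorantHom (g := toB6 (geo9K i) R₀ H₀) (blkSK (κ := κ) i (sIK i bI)) (blkBK (κ := κ) i bI)
      (GcoK i b B cfg O U₁ ∘ₗ DvcoKH i b B cfg U₁)
      (fun a a' => cR39 b * (((d : ℝ) + 1) * (C * c * Real.exp (3 / 4 * δ * ((ℓ : ℝ) + 4)) * (geo9K i).len a ^ 1 *
        Real.exp (-(3 / 4 * δ * (geo9K i).dist a a'))))) := by
  rw [GcoK_comp_DvcoKH_one i b B cfg O hU₁]
  exact hasMajorantHom_smul_of_nonneg
    (hasMajorantHom_coordOpKH_of_liftY b (G := toB6 (geo9K i) R₀ H₀) (blk' := sIK i bI) (blk := bI)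
      (T := fun _ : Fin (d + 1) => Gop i ∘ₗ Matrix.toLin' (gradK i)) (fun _ ω E => O_gradY_one_liftY i O hO ω E)
      fun _ => hasMajorantHom_comp_gradK_sIK_bI i hlev hβ1 hC hδ 1 hT h261 R₀ H₀)
    (cR39_nonneg b)

/-- ★★★ **THE LETTER `gD1` OF `Letters313` ∕ `Letters313Z` AT `U = 1`** — `G₀(1)D_v(1) : 𝔠_W⁽⁰⁾ → 𝔠⁽¹⁾` (`|(G₀∂λ)(x)| ≦ B₃·Lʲη·e^{−δ′d(y,y′)}|λ|`,
`x ∈ Δ(y)`, `supp λ ⊂ Δ(y′)`) at ANY letter record `𝔬` over `geo9K i` (carriers `XBK ∕ Y ∕ Z ∕ XSK`) whose `G0 ∕ Dv` at a configuration `U₁` reading `1` are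
pinned to node00-def-Y's `GcoK … O ∕ DvcoKH` (the certificate's `hG0co12 ∕ hDvco12`), `blk = blkBK bI` (`hblk12`), `blkW = blkSK (sIK bI)` (the site pin;
`bI` level- and 1-faithful): (2.136)₃ + `∂λ = −Σ_μ∇*_μJ_μ(λ)` + (2.61).  Constants: `B₃ = cR39 b·(d+1)·C·c·e^{¾δ(ℓ+4)}`, `δ′ = ¾δ`.
[cite: Balaban1985BackgroundPropagators, Thm 3.13 p.426 (letter G₀D, classes W⁰ → 1), (3.153) p.426, (3.17) p.394, Thm 3.3 p.399, Cor. 3.5 p.407; Balaban1984PropagatorsII, Prop. 2.6 (2.136) p.247, Lemma 2.1 (2.61) p.234] -/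
theorem hasMaj_G0_Dv_one (hG : GeoOK (geo9K i)) [Fintype (geo9K i).Site] [Fintype Y] [Fintype Z]
    (hO : ∀ (J : FBondY i → ℝ) (E : 𝔸), O (fun _ _ => 1) (liftY J E) = liftY (Gop i J) E) {U₁ : B.Cfg} (hU₁ : cfg U₁ = fun _ _ => 1)
    {bI : FBondY i → IBondY i} (hlev : ∀ f : FBondY i, lvl i.hN i.D i.hk (bI f) = (blkV1 i.hN i.D f).1.1)
    (hβ1 : ∀ f : FBondY i, (geomT i.D).dist (β i.hN i.D i.hk (bI f)) (blkV1 i.hN i.D f) ≤ 1)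
    (𝔬 : Ops (geo9K i) B (XBK κ i) Y Z (XSK κ i)) (hblk : 𝔬.blk = blkBK i bI) (hblkW : 𝔬.blkW = blkSK i (sIK i bI))
    (hG0 : 𝔬.G0 U₁ = GcoK i b B cfg O U₁) (hDv : 𝔬.Dv U₁ = DvcoKH i b B cfg U₁)
    {C δ c : ℝ} (hC : 0 ≤ C) (hδ : 0 ≤ δ) (hc0 : 0 ≤ c)
    (hT : ∀ μ : Fin (d + 1), HasMajorant (g := geomT i.D) (blkV1 i.hN i.D) (Gop i ∘ₗ DVa (P := PV d ℓ i.m i.K hd hL) μ i.cf)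
      (fun y y' => C * |i.cf|⁻¹ ^ 1 * ((ℓ : ℝ) + 1) ^ (1 * y.1.1) * Real.exp (-(δ * (geomT i.D).dist y y'))))
    (h261 : Ineq261With c (geomT i.D) δ (1 / 4)) {R₀ : ℝ} {H₀ : Prop} :
    HasMaj (cNorm R₀ H₀ 𝔬.blkW hG.lenle 0) (cNorm R₀ H₀ 𝔬.blk hG.lenle 1) (𝔬.G0 U₁ ∘ₗ 𝔬.Dv U₁)
      (fun a a' => cR39 b * (((d : ℝ) + 1) * (C * c * Real.exp (3 / 4 * δ * ((ℓ : ℝ) + 4)))) *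
        Real.exp (-(3 / 4 * δ * (geo9K i).dist a a'))) := by
  rw [hblk, hblkW, hG0, hDv]
  refine hasMaj_cNorm_of_hasMajorantHom_pow hG (by have := cR39_nonneg b; positivity) 1 ?_
  exact B6RandomWalkHom.hasMajorantHom_mono _ _
    (hasMajorantHom_GcoK_DvcoKH_one i b B cfg O hO hU₁ hlev hβ1 hC hδ hT h261 R₀ H₀) fun a a' => le_of_eq (by ring)

/-- ★★★ **THE LETTER `gD2` OF `Letters313` ∕ `Letters313Z` AT `U = 1`** — the (2.60) scale-transfer twin `G₀(1)D_v(1) : 𝔠_W⁽¹⁾ → 𝔠⁽²⁾`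
(`|(G₀∂λ)(x)| ≦ B₃·(Lʲη)²·e^{−δ′d}·(L^{j′}η)⁻¹|λ|`: one power of `Lʲη` moved to the source block, p. 398), same pins, for members above the threshold
`log L ≤ ε(2L² − 1)M`.  Constants: `B₃ = cR39 b·(d+1)·C·c·e^{¾δ(ℓ+4)}·L`, `δ′ = ¾δ − ε`.
[cite: Balaban1985BackgroundPropagators, Thm 3.13 p.426 (letter G₀D, classes W¹ → 2), p.398 (remark after (3.47)), (3.17) p.394, Cor. 3.5 p.407; Balaban1984PropagatorsII, Prop. 2.6 (2.136) p.247, Lemma 2.1 (2.60)–(2.61) p.234] -/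
theorem hasMaj_G0_Dv_one_transfer (hG : GeoOK (geo9K i)) [Fintype (geo9K i).Site] [Fintype Y] [Fintype Z]
    (hO : ∀ (J : FBondY i → ℝ) (E : 𝔸), O (fun _ _ => 1) (liftY J E) = liftY (Gop i J) E) {U₁ : B.Cfg} (hU₁ : cfg U₁ = fun _ _ => 1)
    {bI : FBondY i → IBondY i} (hlev : ∀ f : FBondY i, lvl i.hN i.D i.hk (bI f) = (blkV1 i.hN i.D f).1.1)
    (hβ1 : ∀ f : FBondY i, (geomT i.D).dist (β i.hN i.D i.hk (bI f)) (blkV1 i.hN i.D f) ≤ 1)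
    (𝔬 : Ops (geo9K i) B (XBK κ i) Y Z (XSK κ i)) (hblk : 𝔬.blk = blkBK i bI) (hblkW : 𝔬.blkW = blkSK i (sIK i bI))
    (hG0 : 𝔬.G0 U₁ = GcoK i b B cfg O U₁) (hDv : 𝔬.Dv U₁ = DvcoKH i b B cfg U₁)
    {C δ c : ℝ} (hC : 0 ≤ C) (hδ : 0 ≤ δ) (hc0 : 0 ≤ c)
    (hT : ∀ μ : Fin (d + 1), HasMajorant (g := geomT i.D) (blkV1 i.hN i.D) (Gop i ∘ₗ DVa (P := PV d ℓ i.m i.K hd hL) μ i.cf)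
      (fun y y' => C * |i.cf|⁻¹ ^ 1 * ((ℓ : ℝ) + 1) ^ (1 * y.1.1) * Real.exp (-(δ * (geomT i.D).dist y y'))))
    (h261 : Ineq261With c (geomT i.D) δ (1 / 4)) {ε : ℝ} (hε : 0 < ε)
    (hM : Real.log (geo9K i).L ≤ ε * (2 * ((ℓ : ℝ) + 1) ^ 2 - 1) * (geo9K i).M) {R₀ : ℝ} {H₀ : Prop} :
    HasMaj (cNorm R₀ H₀ 𝔬.blkW hG.lenle 1) (cNorm R₀ H₀ 𝔬.blk hG.lenle 2) (𝔬.G0 U₁ ∘ₗ 𝔬.Dv U₁)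
      (fun a a' => cR39 b * (((d : ℝ) + 1) * (C * c * Real.exp (3 / 4 * δ * ((ℓ : ℝ) + 4)))) * (geo9K i).L *
        Real.exp (-((3 / 4 * δ - ε) * (geo9K i).dist a a'))) := by
  rw [hblk, hblkW, hG0, hDv]
  have hK := hasMajorantHom_GcoK_DvcoKH_one i b B cfg O hO hU₁ hlev hβ1 hC hδ hT h261 R₀ H₀
  have hK0 : ∀ a a' : (geo9K i).Site, 0 ≤ cR39 b * (((d : ℝ) + 1) * (C * c * Real.exp (3 / 4 * δ * ((ℓ : ℝ) + 4)) * (geo9K i).len a ^ 1 *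
      Real.exp (-(3 / 4 * δ * (geo9K i).dist a a')))) := fun a a' => by
    have := (hG.lenpos a).le; have := cR39_nonneg b; positivity
  have h0 := B9Thm37AllNorms.hasMaj_of_hasMajorantHom (G := toB6 (geo9K i) R₀ H₀) (blkSK (κ := κ) i (sIK i bI)) (blkBK (κ := κ) i bI) hK0 hK
  refine (hasMaj_cNorm_of_hasMaj hG 2 1 h0).mono fun y y' => ?_
  -- `(Lʲη)(y)⁻² · K·(Lʲη)(y)·e^{−¾δd} · (L^{j′}η)(y′) ≤ K·L·e^{−(¾δ−ε)d}`: one power of `Lʲη` transferred to the source block by (2.60)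
  have ht : (geo9K i).len y' ^ 1 ≤ (geo9K i).L ^ 1 * Real.exp (ε * (geo9K i).dist y y') * (geo9K i).len y ^ 1 :=
    len_pow_le_of_transfer i hε 1 (by rwa [Nat.cast_one, one_mul]) y y'
  rw [pow_one, pow_one, pow_one] at ht
  have hly : 0 < (geo9K i).len y := hG.lenpos y
  set A : ℝ := cR39 b * (((d : ℝ) + 1) * (C * c * Real.exp (3 / 4 * δ * ((ℓ : ℝ) + 4)))) with hA
  have hwt : (geo9K i).len y ^ 1 * wt (geo9K i) 2 y = ((geo9K i).len y)⁻¹ := by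
    rw [wt, pow_one, pow_two, mul_inv, ← mul_assoc, mul_inv_cancel₀ hly.ne', one_mul]
  have hq : ((geo9K i).len y)⁻¹ * (geo9K i).len y' ≤ (geo9K i).L * Real.exp (ε * (geo9K i).dist y y') :=
    (inv_mul_le_iff₀ hly).2 (by linarith)
  calc cR39 b * (((d : ℝ) + 1) * (C * c * Real.exp (3 / 4 * δ * ((ℓ : ℝ) + 4)) * (geo9K i).len y ^ 1 *
          Real.exp (-(3 / 4 * δ * (geo9K i).dist y y')))) * wt (geo9K i) 2 y * (geo9K i).len y' ^ 1
      = A * Real.exp (-(3 / 4 * δ * (geo9K i).dist y y')) * (((geo9K i).len y ^ 1 * wt (geo9K i) 2 y) * (geo9K i).len y') := by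
        rw [hA, pow_one ((geo9K i).len y')]; ring
    _ ≤ A * Real.exp (-(3 / 4 * δ * (geo9K i).dist y y')) * ((geo9K i).L * Real.exp (ε * (geo9K i).dist y y')) := by
        rw [hwt]; exact mul_le_mul_of_nonneg_left hq (by have := cR39_nonneg b; positivity)
    _ = A * (geo9K i).L * Real.exp (-((3 / 4 * δ - ε) * (geo9K i).dist y y')) := by
        rw [show -((3 / 4 * δ - ε) * (geo9K i).dist y y') = -(3 / 4 * δ * (geo9K i).dist y y') + ε * (geo9K i).dist y y' by ring,
          Real.exp_add]; ring

end Letters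

/-! ## §3 UNIFORMLY ON THE CENSUS: one threshold, one rate, one constant (up to the reading factor `cR39 b` of `GcoK`) -/

section Record

variable {𝔸 : Type} [NormedRing 𝔸] [NormedAlgebra ℂ 𝔸] [CompleteSpace 𝔸] [FiniteDimensional ℝ 𝔸]
variable {κ : Type} [Fintype κ]

/-- ★★★ **THE LETTERS `gD1`, `gD2` OF `Letters313` ∕ `Letters313Z` AT `U = 1`, UNIFORMLY ON THE k-LEVEL CENSUS** — two more `U = 1` inhabitants of the
fields of the N06 certificate's displayed `hletters13` body (the `G₀∘D_v` letters of (3.153)'s `G₁DRD*G₁`, flagged «no verbatim (2.136) entry» by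
dag-n06-h: the entry IS (2.136)₃ after `∂λ = −Σ_μ∇*_μJ_μ(λ)`): for the band `0 < b₀ ≤ b₁` there are `M₁, B₃, δ₃ > 0` such that for every index `i`
with `M ≥ M₁`, every basis `b`, every letter record `𝔬` over `geo9K i` with carriers `XBK ∕ Y ∕ Z ∕ XSK` pinned at a configuration `U₁` reading `1` to
`GcoK … O ∕ DvcoKH` (`O(1)(J ⊗ E) = (GJ) ⊗ E`), block maps `blkBK bI` and `blkSK (sIK bI)` with `bI` level- and 1-faithful:
`G₀(U₁)D_v(U₁) : 𝔠_W⁽⁰⁾ → 𝔠⁽¹⁾` and `𝔠_W⁽¹⁾ → 𝔠⁽²⁾` with the majorant `B₃·cR39 b·e^{−δ₃d}`.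
[cite: Balaban1985BackgroundPropagators, Thm 3.13 p.426, (3.153) p.426, (3.17) p.394, Thm 3.3 p.399, p.398 (remark after (3.47)), Cor. 3.5 p.407; Balaban1984PropagatorsII, Prop. 2.6 (2.136) p.247, Lemma 2.1 (2.60)–(2.61) p.234] -/
theorem letters313_Dv_one_kIdx (hb₀ : 0 < b₀) (hb₁ : b₀ ≤ b₁) : ∃ M₁ B₃ δ₃ : ℝ, 0 < M₁ ∧ 0 < B₃ ∧ 0 < δ₃ ∧
    ∀ i : KIdx d ℓ hd hL b₀ b₁, M₁ ≤ (geo9K i).M → ∀ (hG : GeoOK (geo9K i)) [Fintype (geo9K i).Site] {Y Z : Type} [Fintype Y] [Fintype Z]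
      (b : Module.Basis κ ℝ 𝔸) (B : B9.Backgrounds) (cfg : B.Cfg → CfgY 𝔸 i) (O : BondOpY 𝔸 i),
      (∀ (J : FBondY i → ℝ) (E : 𝔸), O (fun _ _ => 1) (liftY J E) = liftY (Gop i J) E) →
      ∀ {U₁ : B.Cfg}, cfg U₁ = (fun _ _ => 1) → ∀ {bI : FBondY i → IBondY i},
      (∀ f : FBondY i, lvl i.hN i.D i.hk (bI f) = (blkV1 i.hN i.D f).1.1) →
      (∀ f : FBondY i, (geomT i.D).dist (β i.hN i.D i.hk (bI f)) (blkV1 i.hN i.D f) ≤ 1) →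
      ∀ (𝔬 : Ops (geo9K i) B (XBK κ i) Y Z (XSK κ i)),
      𝔬.blk = blkBK i bI → 𝔬.blkW = blkSK i (sIK i bI) →
      𝔬.G0 U₁ = GcoK i b B cfg O U₁ → 𝔬.Dv U₁ = DvcoKH i b B cfg U₁ →
      ∀ {R₀ : ℝ} {H₀ : Prop},
        HasMaj (cNorm R₀ H₀ 𝔬.blkW hG.lenle 0) (cNorm R₀ H₀ 𝔬.blk hG.lenle 1) (𝔬.G0 U₁ ∘ₗ 𝔬.Dv U₁)
          (fun a a' => B₃ * cR39 b * Real.exp (-(δ₃ * (geo9K i).dist a a'))) ∧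
        HasMaj (cNorm R₀ H₀ 𝔬.blkW hG.lenle 1) (cNorm R₀ H₀ 𝔬.blk hG.lenle 2) (𝔬.G0 U₁ ∘ₗ 𝔬.Dv U₁)
          (fun a a' => B₃ * cR39 b * Real.exp (-(δ₃ * (geo9K i).dist a a'))) := by
  obtain ⟨M₁, δ₃, C, hM₁, hδ₃, hC, H⟩ := hasMajorant_Gop_kIdx (d := d) (ℓ := ℓ) (hd := hd) (hL := hL) hb₀ hb₁
  obtain ⟨N, c, -, hc0, hcon⟩ := consts_260_261 d ℓ hδ₃
  -- rate: `ε := δ₃ ∕ 4` in the transfer of `gD2` (`¾δ₃ − ¼δ₃ = ½δ₃`); (2.60) threshold `4 log L ∕ δ₃`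
  set Lr : ℝ := (((ℓ + 1 : ℕ) : ℝ)) with hLr
  have hLr1 : 1 ≤ Lr := by rw [hLr]; exact_mod_cast Nat.succ_le_succ (Nat.zero_le ℓ)
  set lg : ℝ := Real.log Lr with hlg
  have hlg0 : 0 ≤ lg := Real.log_nonneg hLr1
  set B₃ : ℝ := ((d : ℝ) + 1) * (C * (c + 1) * Real.exp (3 / 4 * δ₃ * ((ℓ : ℝ) + 4))) * Lr with hB₃
  have hB₃pos : 0 < B₃ := by positivity
  refine ⟨max (max M₁ ((N : ℝ) + 1)) (4 * lg / δ₃), B₃, δ₃ / 2, lt_max_of_lt_left (lt_max_of_lt_left hM₁), hB₃pos, by positivity, ?_⟩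
  intro i hM hG _ Y Z _ _ b B cfg O hO U₁ hU₁ bI hlev hβ1 𝔬 hblk hblkW hG0 hDv R₀ H₀
  have hLcast : (((ℓ + 1 : ℕ) : ℝ)) = (ℓ : ℝ) + 1 := by push_cast; ring
  have hMdef : (geo9K i).M = (((ℓ + 1 : ℕ) : ℝ)) * (i.Mh : ℝ) := rfl
  have hLdef : (geo9K i).L = Lr := rfl
  have hM₁ : M₁ ≤ (kGeoG i).M := ((le_max_left _ _).trans (le_max_left _ _)).trans hM
  have hN : (N : ℝ) + 1 ≤ ((ℓ : ℝ) + 1) * i.Mh := by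
    rw [← hLcast, ← hMdef]; exact ((le_max_right _ _).trans (le_max_left _ _)).trans hM
  have hMw : 4 * lg ≤ (geo9K i).M * δ₃ := (div_le_iff₀ hδ₃).mp ((le_max_right _ _).trans hM)
  have hR1 : 1 ≤ i.R := le_trans (by omega) (toKT i).hR
  have hRN : N + 1 ≤ i.R * ((ℓ + 1) * i.Mh) := by
    have h2 : N + 1 ≤ (ℓ + 1) * i.Mh := by exact_mod_cast hN
    calc N + 1 ≤ 1 * ((ℓ + 1) * i.Mh) := by rw [one_mul]; exact h2
      _ ≤ i.R * ((ℓ + 1) * i.Mh) := Nat.mul_le_mul_right _ hR1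
  obtain ⟨-, h261⟩ := hcon i.k i.Mh i.R i.P' (one_le_Mh i) (toKT i).hP hRN
  have h261D : Ineq261With c (geomT i.D) δ₃ (1 / 4) := h261 i.D
  obtain ⟨-, -, h2, -⟩ := H i hM₁
  -- threshold of the (2.60) transfer with `ε := δ₃ ∕ 4`
  have hε4 : 0 < δ₃ / 4 := by positivity
  have hMg1 : ((1 : ℕ) : ℝ) * lg / (δ₃ / 4) ≤ (geo9K i).M := by rw [div_le_iff₀ hε4]; push_cast; linarith
  have hT1 := transfer_threshold i hε4 1 hMg1
  -- the two bodies
  have hA := hasMaj_G0_Dv_one (Y := Y) (Z := Z) (R₀ := R₀) (H₀ := H₀) i b B cfg O hG hO hU₁ hlev hβ1 𝔬 hblk hblkW hG0 hDv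
    hC.le hδ₃.le hc0 h2 h261D
  have hB := hasMaj_G0_Dv_one_transfer (Y := Y) (Z := Z) (R₀ := R₀) (H₀ := H₀) i b B cfg O hG hO hU₁ hlev hβ1 𝔬 hblk hblkW hG0 hDv
    hC.le hδ₃.le hc0 h2 h261D hε4 (by simpa using hT1)
  have hcb : 0 ≤ cR39 b := cR39_nonneg b
  -- `A ≤ A′ ≤ A′·L` for the constants `A = (d+1)·C·c·e^{…}`, `A′ = (d+1)·C·(c+1)·e^{…}`
  have hAA' : ((d : ℝ) + 1) * (C * c * Real.exp (3 / 4 * δ₃ * ((ℓ : ℝ) + 4))) ≤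
      ((d : ℝ) + 1) * (C * (c + 1) * Real.exp (3 / 4 * δ₃ * ((ℓ : ℝ) + 4))) := by gcongr; linarith
  have hAL : ((d : ℝ) + 1) * (C * c * Real.exp (3 / 4 * δ₃ * ((ℓ : ℝ) + 4))) ≤
      ((d : ℝ) + 1) * (C * (c + 1) * Real.exp (3 / 4 * δ₃ * ((ℓ : ℝ) + 4))) * Lr := hAA'.trans (le_mul_of_one_le_right (by positivity) hLr1)
  refine ⟨hA.mono fun a a' => ?_, hB.mono fun a a' => ?_⟩
  · have hda : 0 ≤ (geo9K i).dist a a' := hG.dnn a a'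
    have hrate : Real.exp (-(3 / 4 * δ₃ * (geo9K i).dist a a')) ≤ Real.exp (-(δ₃ / 2 * (geo9K i).dist a a')) :=
      Real.exp_le_exp.2 (by nlinarith)
    calc cR39 b * (((d : ℝ) + 1) * (C * c * Real.exp (3 / 4 * δ₃ * ((ℓ : ℝ) + 4)))) * Real.exp (-(3 / 4 * δ₃ * (geo9K i).dist a a'))
        ≤ cR39 b * (((d : ℝ) + 1) * (C * (c + 1) * Real.exp (3 / 4 * δ₃ * ((ℓ : ℝ) + 4))) * Lr) * Real.exp (-(δ₃ / 2 * (geo9K i).dist a a')) :=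
          mul_le_mul (mul_le_mul_of_nonneg_left hAL hcb) hrate (Real.exp_pos _).le (mul_nonneg hcb (by positivity))
      _ = B₃ * cR39 b * Real.exp (-(δ₃ / 2 * (geo9K i).dist a a')) := by rw [hB₃]; ring
  · have hre : Real.exp (-((3 / 4 * δ₃ - δ₃ / 4) * (geo9K i).dist a a')) = Real.exp (-(δ₃ / 2 * (geo9K i).dist a a')) := by
      congr 1; ring
    rw [hre, hLdef]
    calc cR39 b * (((d : ℝ) + 1) * (C * c * Real.exp (3 / 4 * δ₃ * ((ℓ : ℝ) + 4)))) * Lr * Real.exp (-(δ₃ / 2 * (geo9K i).dist a a'))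
        ≤ cR39 b * (((d : ℝ) + 1) * (C * (c + 1) * Real.exp (3 / 4 * δ₃ * ((ℓ : ℝ) + 4)))) * Lr * Real.exp (-(δ₃ / 2 * (geo9K i).dist a a')) :=
          mul_le_mul_of_nonneg_right (mul_le_mul_of_nonneg_right (mul_le_mul_of_nonneg_left hAA' hcb) (by positivity)) (Real.exp_pos _).le
      _ = B₃ * cR39 b * Real.exp (-(δ₃ / 2 * (geo9K i).dist a a')) := by rw [hB₃]; ring

end Record

end Literature.MathematicalPhysics.QuantumFieldTheory.Balaban1983to89.B9Letters313AtOneDv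

end
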